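import Summits.QuantumFields.QCD.Theorems.HeatSlicedQuarksQuarkLoopCoefficientSecondOrderExpansionAuxJ

/-!
# Second-order expansion of the heat symbol — part K: the second-order remainder `R₂`
(line `Sketch` of crux stmt-QuantumFields-16786, stub `stub_secondOrderExpansion`, helper file)

The remainder `R₂(s)(w) = E_θ(s)(w) − E₀(s)(w) − θ E₁(s)(w)` (`E_θ = symHeat θ`, `E₀ = pert0`, `E₁ = pert1`)
satisfies the hypotheses of the twisted Duhamel principle (`stub_twistedDuhamel`) with the forcing
`q₂ = V_θ(E₀ + θE₁) − vtx0 E₀ − θ(vtx0 E₁ + vtx1 E₀)`: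

* the ODE `∂_s R₂ = −V_θ R₂ − q₂` on `s > 0` (evolution equation of the heat symbol, ODEs of `E₀`, `E₁`),
  `R₂(0) = 0`;
* continuity of the entries of `R₂` and `q₂`, a uniform bound of `R₂`, and the profile bound of `q₂` on
  bounded time intervals;
* the entrywise bound of the twisted convolution `Σ_y Ω_θ(y,w) • (E(y) q(w−y))` of two profile-bounded
  fields, and the twisted Duhamel representation of `R₂` (hypothesis: the registered aux stub
  `stub_twistedDuhamel`).
-/

noncomputable section

namespace Summit.QuantumFields.QCD.Cruxes.QuarkLoopCoefficient.Sketch.SecondOrderExpansion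

open Literature.MathematicalPhysics.QuantumLattice Literature.MathematicalPhysics.QuantumFieldTheory
open Literature.Probability.LatticeModels (Site)
open Summit.QuantumFields.QCD.Theorems.QuarkLoopCoefficient
open Summit.QuantumFields.QCD.Cruxes.QuarkLoopCoefficient.Sketch.HeatSeries
open Summit.QuantumFields.QCD.Cruxes.QuarkLoopCoefficient.Sketch.FreeMajorantToolkit
open Summit.QuantumFields.QCD.Cruxes.QuarkLoopCoefficient.Sketch.SymmetricGauge
open scoped Matrix ComplexConjugate

/-- The twisted generator `(V_θ f)(w) = Σ_{v ∈ nbr2 0} Ω_θ(v, w) • (ȟ_θ(v) f(w − v))` (local notation). -/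
local notation "V[" θ "]" => (fun (f : Site 4 → Spin) (w : Site 4) =>
  ∑ v ∈ nbr2 0, Complex.exp (((θ / 2 * (wedge v w : ℤ) : ℝ) : ℂ) * Complex.I) • (sqKer (symLink θ) 0 v * f (w - v)))

/-- The second-order forcing `q₂(θ, s, w)` (local notation). -/
local notation "Q₂[" θ "," s "," w "]" => (V[θ] (pert0 s) w + (θ : ℂ) • V[θ] (pert1 s) w - vtx 0 (pert0 s) w -
  (θ : ℂ) • (vtx 0 (pert1 s) w + vtx 1 (pert0 s) w))

/-! ## §24 The ODE of the second-order remainder -/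

/-- **ODE of `R₂`**: for `s > 0`,
`∂_s (E_θ − E₀ − θE₁)(s)(w)_{αβ} = (−V_θ (E_θ − E₀ − θE₁)(s) (w) − q₂(θ,s,w))_{αβ}`. -/
theorem hasDerivAt_remainder₂_apply
    (h1 : ∀ x y : Site 4, sqKer (fun _ => (1 : ℂ)) x y = ((hhat (y - x) : ℝ) : ℂ) • (1 : Spin))
    (h3 : ∀ w : Site 4, freeKer 0 w = if w = 0 then 1 else 0)
    (h4 : ∀ (t : ℝ) (w : Site 4),
      HasDerivAt (fun s => freeKer s w) (-(∑ z ∈ nbr2 0, hhat z * freeKer t (w - z))) t)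
    (h5 : ∀ s r : ℝ, 0 ≤ s → 0 ≤ r → ∀ w : Site 4,
      HasSum (fun y : Site 4 => freeKer s y * freeKer r (w - y)) (freeKer (s + r) w))
    (h6 : ∀ t : ℝ, 0 ≤ t → ∀ (w : Site 4) (ν : Fin 4),
      t * (∑ z ∈ nbr2 0, ((z ν : ℤ) : ℝ) * hhat z * freeKer t (w - z)) + ((w ν : ℤ) : ℝ) * freeKer t w = 0)
    (θ : ℝ) {s : ℝ} (hs : 0 < s) (w : Site 4) (α β : Fin 4) :
    HasDerivAt (fun r : ℝ => (symHeat θ r w - pert0 r w - (θ : ℂ) • pert1 r w) α β)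
      ((-(∑ v ∈ nbr2 0, Complex.exp (((θ / 2 * (wedge v w : ℤ) : ℝ) : ℂ) * Complex.I) •
          (sqKer (symLink θ) 0 v *
            (symHeat θ s (w - v) - pert0 s (w - v) - (θ : ℂ) • pert1 s (w - v)))) - Q₂[θ, s, w]) α β) s := by
  have hE := hasDerivAt_symHeat θ s w α β
  have hP0 := hasDerivAt_pert0_apply h1 h4 s w α β
  have hP1 := (hasDerivAt_pert1_apply h1 h3 h4 h5 h6 hs w α β).const_mul (θ : ℂ)
  have h := (hE.sub hP0).sub hP1
  have hfun : (fun r : ℝ => (symHeat θ r w - pert0 r w - (θ : ℂ) • pert1 r w) α β) =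
      fun r : ℝ => symHeat θ r w α β - pert0 r w α β - (θ : ℂ) * pert1 r w α β := by
    funext r; simp [Matrix.sub_apply, Matrix.smul_apply]
  rw [hfun]
  refine h.congr_deriv ?_
  -- the algebra `−V E + vtx0 E₀ + θ(vtx0 E₁ + vtx1 E₀) = −V(E − E₀ − θE₁) − q₂`
  have key : -(∑ v ∈ nbr2 0, Complex.exp (((θ / 2 * (wedge v w : ℤ) : ℝ) : ℂ) * Complex.I) •
        (sqKer (symLink θ) 0 v * symHeat θ s (w - v))) - -(vtx 0 (pert0 s) w) -
        (θ : ℂ) • (-(vtx 0 (pert1 s) w) - vtx 1 (pert0 s) w) =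
      -(∑ v ∈ nbr2 0, Complex.exp (((θ / 2 * (wedge v w : ℤ) : ℝ) : ℂ) * Complex.I) •
          (sqKer (symLink θ) 0 v *
            (symHeat θ s (w - v) - pert0 s (w - v) - (θ : ℂ) • pert1 s (w - v)))) - Q₂[θ, s, w] := by
    simp only [Matrix.mul_sub, Matrix.mul_smul, smul_sub, Finset.sum_sub_distrib, Finset.smul_sum, smul_smul,
      mul_comm _ (θ : ℂ)]
    simp only [← smul_smul, ← Finset.smul_sum, smul_add, smul_neg, neg_sub, sub_neg_eq_add]
    abel
  have := congrFun (congrFun key α) β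
  simp only [Matrix.sub_apply, Matrix.neg_apply, Matrix.smul_apply, smul_eq_mul] at this
  simpa only [Matrix.sub_apply, Matrix.neg_apply, Matrix.smul_apply, smul_eq_mul] using this

/-- `R₂(0) = 0`: at time zero the heat symbol, `E₀` and `E₁` are `δ`, `δ`, `0`. -/
theorem remainder₂_zero
    (h1 : ∀ x y : Site 4, sqKer (fun _ => (1 : ℂ)) x y = ((hhat (y - x) : ℝ) : ℂ) • (1 : Spin))
    (h3 : ∀ w : Site 4, freeKer 0 w = if w = 0 then 1 else 0)
    (h5 : ∀ s r : ℝ, 0 ≤ s → 0 ≤ r → ∀ w : Site 4,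
      HasSum (fun y : Site 4 => freeKer s y * freeKer r (w - y)) (freeKer (s + r) w))
    (h6 : ∀ t : ℝ, 0 ≤ t → ∀ (w : Site 4) (ν : Fin 4),
      t * (∑ z ∈ nbr2 0, ((z ν : ℤ) : ℝ) * hhat z * freeKer t (w - z)) + ((w ν : ℤ) : ℝ) * freeKer t w = 0)
    (θ : ℝ) (w : Site 4) : symHeat θ 0 w - pert0 0 w - (θ : ℂ) • pert1 0 w = 0 := by
  rw [pert1_eq h1 h3 h5 h6 le_rfl w, symHeat, heatKer_zero (norm_symLink_le θ), pert0, h3]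
  simp only [Complex.ofReal_zero, zero_smul, neg_zero, smul_zero, sub_zero]
  by_cases hw : (0 : Site 4) = w
  · subst hw; simp
  · have hw' : ¬(w = 0) := fun e => hw e.symm
    simp [hw, hw']

/-! ## §25 Continuity of the entries of `R₂` and `q₂` -/

/-- The heat symbol is continuous in time (entrywise). -/
theorem continuous_symHeat_apply (θ : ℝ) (w : Site 4) (α β : Fin 4) :
    Continuous fun s : ℝ => symHeat θ s w α β :=
  continuous_iff_continuousAt.mpr fun s => (hasDerivAt_symHeat θ s w α β).continuousAt

/-- Continuity of the entries of `R₂` on `[0, ∞)`. -/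
theorem continuousOn_remainder₂_apply
    (h1 : ∀ x y : Site 4, sqKer (fun _ => (1 : ℂ)) x y = ((hhat (y - x) : ℝ) : ℂ) • (1 : Spin))
    (h3 : ∀ w : Site 4, freeKer 0 w = if w = 0 then 1 else 0)
    (h4 : ∀ (t : ℝ) (w : Site 4),
      HasDerivAt (fun s => freeKer s w) (-(∑ z ∈ nbr2 0, hhat z * freeKer t (w - z))) t)
    (h5 : ∀ s r : ℝ, 0 ≤ s → 0 ≤ r → ∀ w : Site 4,
      HasSum (fun y : Site 4 => freeKer s y * freeKer r (w - y)) (freeKer (s + r) w))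
    (h6 : ∀ t : ℝ, 0 ≤ t → ∀ (w : Site 4) (ν : Fin 4),
      t * (∑ z ∈ nbr2 0, ((z ν : ℤ) : ℝ) * hhat z * freeKer t (w - z)) + ((w ν : ℤ) : ℝ) * freeKer t w = 0)
    (θ : ℝ) (w : Site 4) (α β : Fin 4) :
    ContinuousOn (fun s : ℝ => (symHeat θ s w - pert0 s w - (θ : ℂ) • pert1 s w) α β) (Set.Ici 0) := by
  have hfun : (fun s : ℝ => (symHeat θ s w - pert0 s w - (θ : ℂ) • pert1 s w) α β) =
      fun s : ℝ => symHeat θ s w α β - pert0 s w α β - (θ : ℂ) * pert1 s w α β := by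
    funext s; simp [Matrix.sub_apply, Matrix.smul_apply]
  rw [hfun]
  exact (((continuous_symHeat_apply θ w α β).continuousOn).sub (continuous_pert0_apply h4 w α β).continuousOn).sub
    (continuousOn_const.mul (continuousOn_pert1_apply h1 h3 h4 h5 h6 w α β))

/-- Continuity of the entries of the twisted generator applied to a time-dependent field. -/
theorem continuousOn_twistedGen_apply (θ : ℝ) {f : ℝ → Site 4 → Spin} {S : Set ℝ}
    (hf : ∀ (y : Site 4) (γ δ : Fin 4), ContinuousOn (fun s : ℝ => f s y γ δ) S) (w : Site 4) (α β : Fin 4) :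
    ContinuousOn (fun s : ℝ => (V[θ] (f s) w) α β) S := by
  simp only [Matrix.sum_apply, Matrix.smul_apply, Matrix.mul_apply, smul_eq_mul, Finset.mul_sum]
  refine continuousOn_finsetSum _ fun v _ => continuousOn_finsetSum _ fun γ _ => ?_
  exact continuousOn_const.mul (continuousOn_const.mul (hf (w - v) γ β))

/-- Continuity of the entries of a vertex applied to a time-dependent field. -/
theorem continuousOn_vtx_apply (j : ℕ) {f : ℝ → Site 4 → Spin} {S : Set ℝ}
    (hf : ∀ (y : Site 4) (γ δ : Fin 4), ContinuousOn (fun s : ℝ => f s y γ δ) S) (w : Site 4) (α β : Fin 4) :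
    ContinuousOn (fun s : ℝ => (vtx j (f s) w) α β) S := by
  unfold vtx
  simp only [Matrix.sum_apply, Matrix.smul_apply, Matrix.mul_apply, smul_eq_mul, Finset.mul_sum]
  refine continuousOn_finsetSum _ fun v _ => continuousOn_finsetSum _ fun z _ =>
    continuousOn_finsetSum _ fun γ _ => ?_
  exact continuousOn_const.mul (continuousOn_const.mul (hf (w - v) γ β))

/-- Continuity of the entries of the forcing `q₂` on `[0, ∞)`. -/
theorem continuousOn_forcing₂_apply
    (h1 : ∀ x y : Site 4, sqKer (fun _ => (1 : ℂ)) x y = ((hhat (y - x) : ℝ) : ℂ) • (1 : Spin))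
    (h3 : ∀ w : Site 4, freeKer 0 w = if w = 0 then 1 else 0)
    (h4 : ∀ (t : ℝ) (w : Site 4),
      HasDerivAt (fun s => freeKer s w) (-(∑ z ∈ nbr2 0, hhat z * freeKer t (w - z))) t)
    (h5 : ∀ s r : ℝ, 0 ≤ s → 0 ≤ r → ∀ w : Site 4,
      HasSum (fun y : Site 4 => freeKer s y * freeKer r (w - y)) (freeKer (s + r) w))
    (h6 : ∀ t : ℝ, 0 ≤ t → ∀ (w : Site 4) (ν : Fin 4),
      t * (∑ z ∈ nbr2 0, ((z ν : ℤ) : ℝ) * hhat z * freeKer t (w - z)) + ((w ν : ℤ) : ℝ) * freeKer t w = 0)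
    (θ : ℝ) (w : Site 4) (α β : Fin 4) :
    ContinuousOn (fun s : ℝ => (Q₂[θ, s, w]) α β) (Set.Ici 0) := by
  have hP0 : ∀ (y : Site 4) (γ δ : Fin 4), ContinuousOn (fun s : ℝ => pert0 s y γ δ) (Set.Ici 0) :=
    fun y γ δ => (continuous_pert0_apply h4 y γ δ).continuousOn
  have hP1 : ∀ (y : Site 4) (γ δ : Fin 4), ContinuousOn (fun s : ℝ => pert1 s y γ δ) (Set.Ici 0) :=
    fun y γ δ => continuousOn_pert1_apply h1 h3 h4 h5 h6 y γ δ
  have a := continuousOn_twistedGen_apply θ hP0 w α β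
  have b := continuousOn_twistedGen_apply θ hP1 w α β
  have c := continuousOn_vtx_apply 0 hP0 w α β
  have d := continuousOn_vtx_apply 0 hP1 w α β
  have e := continuousOn_vtx_apply 1 hP0 w α β
  have hfun : (fun s : ℝ => (Q₂[θ, s, w]) α β) = fun s : ℝ =>
      (V[θ] (pert0 s) w) α β + (θ : ℂ) * (V[θ] (pert1 s) w) α β - (vtx 0 (pert0 s) w) α β -
        (θ : ℂ) * ((vtx 0 (pert1 s) w) α β + (vtx 1 (pert0 s) w) α β) := by
    funext s
    simp only [Matrix.sub_apply, Matrix.add_apply, Matrix.smul_apply, smul_eq_mul]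
  rw [hfun]
  exact ((a.add (continuousOn_const.mul b)).sub c).sub (continuousOn_const.mul (d.add e))

/-! ## §26 Uniform bounds on bounded time intervals -/

/-- A uniform bound of the entries of `R₂` on `[0, T]`. -/
theorem norm_remainder₂_apply_le {Ck ck : ℝ} (hck : 0 < ck)
    (hk : ∀ t : ℝ, 0 ≤ t → ∀ w : Site 4, |freeKer t w| ≤ Ck * gaussProfile ck t w)
    (hT4 : ∀ c ε : ℝ, 0 < c → 0 < ε → ε < 1 → ∃ A : ℝ, ∀ t : ℝ, 0 ≤ t → ∀ w z : Site 4, elen z ≤ 2 →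
      gaussProfile c t (w + z) ≤ A * gaussProfile ((1 - ε) * c) t w)
    (h1 : ∀ x y : Site 4, sqKer (fun _ => (1 : ℂ)) x y = ((hhat (y - x) : ℝ) : ℂ) • (1 : Spin))
    (h3 : ∀ w : Site 4, freeKer 0 w = if w = 0 then 1 else 0)
    (h5 : ∀ s r : ℝ, 0 ≤ s → 0 ≤ r → ∀ w : Site 4,
      HasSum (fun y : Site 4 => freeKer s y * freeKer r (w - y)) (freeKer (s + r) w))
    (h6 : ∀ t : ℝ, 0 ≤ t → ∀ (w : Site 4) (ν : Fin 4),
      t * (∑ z ∈ nbr2 0, ((z ν : ℤ) : ℝ) * hhat z * freeKer t (w - z)) + ((w ν : ℤ) : ℝ) * freeKer t w = 0) :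
    ∃ C₁ : ℝ, 0 ≤ C₁ ∧ ∀ (θ T : ℝ), ∀ s ∈ Set.Icc 0 T, ∀ (w : Site 4) (α β : Fin 4),
      ‖(symHeat θ s w - pert0 s w - (θ : ℂ) • pert1 s w) α β‖ ≤
        Real.exp (1679616 * T) + Ck + |θ| * (C₁ * (1 + T)) := by
  obtain ⟨C₁, hC₁0, hE₁⟩ := exists_norm_pert1_apply_le hck hk hT4 h1 h3 h5 h6
  have hCk : 0 ≤ Ck := by
    have := hk 0 le_rfl 0
    have h0 : 0 < gaussProfile ck 0 0 := by rw [gaussProfile_zero_right]; norm_num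
    nlinarith [abs_nonneg (freeKer 0 0)]
  refine ⟨C₁, hC₁0, fun θ T s hs w α β => ?_⟩
  rw [Matrix.sub_apply, Matrix.sub_apply, Matrix.smul_apply, smul_eq_mul]
  refine (norm_sub_le _ _).trans (add_le_add ((norm_sub_le _ _).trans (add_le_add ?_ ?_)) ?_)
  · refine (norm_heatKer_apply_le (norm_symLink_le θ) s 0 w α β).trans ?_
    rw [Real.exp_le_exp, abs_of_nonneg hs.1]
    nlinarith [hs.2]
  · exact (norm_pert0_apply_le hk hs.1 w α β).trans
      (mul_le_of_le_one_right hCk (gaussProfile_le_one hck.le hs.1 w))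
  · rw [norm_mul, Complex.norm_real, Real.norm_eq_abs]
    refine mul_le_mul_of_nonneg_left ((hE₁ s hs.1 w α β).trans ?_) (abs_nonneg θ)
    calc C₁ * (1 + s) * gaussProfile (ck / 2) s w ≤ C₁ * (1 + s) * 1 :=
          mul_le_mul_of_nonneg_left (gaussProfile_le_one (half_pos hck).le hs.1 w) (by nlinarith [hs.1])
      _ ≤ C₁ * (1 + T) := by rw [mul_one]; gcongr; exact hs.2




/-! ## §27 Twisted convolution of profile-bounded fields -/

/-- **Twisted convolution bound.**  If `‖E(y)_{αγ}‖ ≤ a Γ_{c/2}(u,y)` and `‖q(y)_{γβ}‖ ≤ b Γ_c(s,y)`, then the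
family `y ↦ Ω_θ(y,w) • (E(y) q(w−y))` is summable (entrywise, hence in `Spin`) and
`‖(Σ_y Ω_θ(y,w) • (E(y) q(w−y)))_{αβ}‖ ≤ 4 a b B Γ_{c/2}(u+s, w)` (`B` the mixed-convolution constant). -/
theorem twistedConv_summable_and_norm_le {c B : ℝ}
    (hB : ∀ a b : ℝ, 0 ≤ a → 0 ≤ b → ∀ w : Site 4,
      Summable (fun y : Site 4 => gaussProfile ((1 - 1 / 2) * c) a y * gaussProfile c b (w - y)) ∧
      ∑' y : Site 4, gaussProfile ((1 - 1 / 2) * c) a y * gaussProfile c b (w - y) ≤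
        B * gaussProfile ((1 - 1 / 2) * c) (a + b) w)
    (θ : ℝ) {E q : Site 4 → Spin} {a b u s : ℝ} (ha : 0 ≤ a) (hb : 0 ≤ b) (hu : 0 ≤ u) (hs : 0 ≤ s)
    (hE : ∀ (y : Site 4) (α γ : Fin 4), ‖E y α γ‖ ≤ a * gaussProfile (c / 2) u y)
    (hq : ∀ (y : Site 4) (γ β : Fin 4), ‖q y γ β‖ ≤ b * gaussProfile c s y) (w : Site 4) :
    Summable (fun y : Site 4 => Complex.exp (((θ / 2 * (wedge y w : ℤ) : ℝ) : ℂ) * Complex.I) • (E y * q (w - y))) ∧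
    ∀ α β : Fin 4, ‖(∑' y : Site 4,
        Complex.exp (((θ / 2 * (wedge y w : ℤ) : ℝ) : ℂ) * Complex.I) • (E y * q (w - y))) α β‖ ≤
      4 * a * b * B * gaussProfile (c / 2) (u + s) w := by
  have hc2 : (1 - 1 / 2) * c = c / 2 := by ring
  obtain ⟨hsum, hle⟩ := hB u s hu hs w
  rw [hc2] at hsum hle
  -- entrywise domination
  have hdom : ∀ (α β : Fin 4) (y : Site 4),
      ‖(Complex.exp (((θ / 2 * (wedge y w : ℤ) : ℝ) : ℂ) * Complex.I) • (E y * q (w - y))) α β‖ ≤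
        4 * a * b * (gaussProfile (c / 2) u y * gaussProfile c s (w - y)) := by
    intro α β y
    refine (norm_smul_apply_le _ (norm_mul_apply_le (hE y) (hq (w - y))) α β).trans ?_
    rw [norm_cexp_wedge, one_mul]
    exact le_of_eq (by ring)
  have hsumαβ : ∀ α β : Fin 4, Summable (fun y : Site 4 =>
      (Complex.exp (((θ / 2 * (wedge y w : ℤ) : ℝ) : ℂ) * Complex.I) • (E y * q (w - y))) α β) :=
    fun α β => Summable.of_norm_bounded (hsum.mul_left (4 * a * b)) (hdom α β)
  have hS : Summable (fun y : Site 4 =>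
      Complex.exp (((θ / 2 * (wedge y w : ℤ) : ℝ) : ℂ) * Complex.I) • (E y * q (w - y))) :=
    Pi.summable.mpr fun α => Pi.summable.mpr fun β => hsumαβ α β
  refine ⟨hS, fun α β => ?_⟩
  have e1 : (∑' y : Site 4, Complex.exp (((θ / 2 * (wedge y w : ℤ) : ℝ) : ℂ) * Complex.I) • (E y * q (w - y))) α =
      ∑' y : Site 4, (Complex.exp (((θ / 2 * (wedge y w : ℤ) : ℝ) : ℂ) * Complex.I) • (E y * q (w - y))) α :=
    tsum_apply hS
  have e2 : (∑' y : Site 4, (Complex.exp (((θ / 2 * (wedge y w : ℤ) : ℝ) : ℂ) * Complex.I) • (E y * q (w - y))) α) β =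
      ∑' y : Site 4, (Complex.exp (((θ / 2 * (wedge y w : ℤ) : ℝ) : ℂ) * Complex.I) • (E y * q (w - y))) α β :=
    tsum_apply (Pi.summable.mp hS α)
  rw [show (∑' y : Site 4, Complex.exp (((θ / 2 * (wedge y w : ℤ) : ℝ) : ℂ) * Complex.I) • (E y * q (w - y))) α β =
      ((∑' y : Site 4, Complex.exp (((θ / 2 * (wedge y w : ℤ) : ℝ) : ℂ) * Complex.I) • (E y * q (w - y))) α) β
      from rfl, e1, e2]
  refine (tsum_of_norm_bounded ((hsum.mul_left (4 * a * b)).hasSum) (hdom α β)).trans ?_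
  rw [tsum_mul_left]
  calc 4 * a * b * ∑' y : Site 4, gaussProfile (c / 2) u y * gaussProfile c s (w - y)
      ≤ 4 * a * b * (B * gaussProfile (c / 2) (u + s) w) := mul_le_mul_of_nonneg_left hle (by positivity)
    _ = _ := by ring

/-! ## §28 The twisted Duhamel representation of `R₂` -/

/-- **Duhamel representation of `R₂`** (from the registered aux stub `stub_twistedDuhamel`, taken as the
hypothesis `hTD`): for every `θ` and `t > 0`,
`(E_θ − E₀ − θE₁)(t)(w)_{αβ} = −∫₀ᵗ (Σ_y Ω_θ(y,w) • (E_θ(t−s)(y) q₂(θ,s,w−y)))_{αβ} ds`. -/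
theorem remainder₂_eq_integral {Ck ck : ℝ} (hck : 0 < ck)
    (hk : ∀ t : ℝ, 0 ≤ t → ∀ w : Site 4, |freeKer t w| ≤ Ck * gaussProfile ck t w)
    (hT3 : ∀ c ε : ℝ, 0 < c → 0 < ε → ε < 1 → ∀ j : ℕ, ∃ A : ℝ, ∀ t : ℝ, 0 ≤ t → ∀ w : Site 4,
      elen w ^ j * gaussProfile c t w ≤ A * Real.sqrt (1 + t) ^ j * gaussProfile ((1 - ε) * c) t w)
    (hT4 : ∀ c ε : ℝ, 0 < c → 0 < ε → ε < 1 → ∃ A : ℝ, ∀ t : ℝ, 0 ≤ t → ∀ w z : Site 4, elen z ≤ 2 →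
      gaussProfile c t (w + z) ≤ A * gaussProfile ((1 - ε) * c) t w)
    (h1 : ∀ x y : Site 4, sqKer (fun _ => (1 : ℂ)) x y = ((hhat (y - x) : ℝ) : ℂ) • (1 : Spin))
    (h3 : ∀ w : Site 4, freeKer 0 w = if w = 0 then 1 else 0)
    (h4 : ∀ (t : ℝ) (w : Site 4),
      HasDerivAt (fun s => freeKer s w) (-(∑ z ∈ nbr2 0, hhat z * freeKer t (w - z))) t)
    (h5 : ∀ s r : ℝ, 0 ≤ s → 0 ≤ r → ∀ w : Site 4,
      HasSum (fun y : Site 4 => freeKer s y * freeKer r (w - y)) (freeKer (s + r) w))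
    (h6 : ∀ t : ℝ, 0 ≤ t → ∀ (w : Site 4) (ν : Fin 4),
      t * (∑ z ∈ nbr2 0, ((z ν : ℤ) : ℝ) * hhat z * freeKer t (w - z)) + ((w ν : ℤ) : ℝ) * freeKer t w = 0)
    (hTD : ∀ (θ T c B : ℝ), 0 < T → 0 < c → ∀ (X q : ℝ → Site 4 → Spin),
      (∀ w : Site 4, X 0 w = 0) →
      (∀ (w : Site 4) (α β : Fin 4), ContinuousOn (fun s => X s w α β) (Set.Icc 0 T)) →
      (∀ (w : Site 4) (α β : Fin 4), ContinuousOn (fun s => q s w α β) (Set.Icc 0 T)) →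
      (∀ s ∈ Set.Ioo 0 T, ∀ (w : Site 4) (α β : Fin 4),
        HasDerivAt (fun r => X r w α β)
          ((-(∑ v ∈ nbr2 0, Complex.exp (((θ / 2 * (wedge v w : ℤ) : ℝ) : ℂ) * Complex.I) •
              (sqKer (symLink θ) 0 v * X s (w - v))) - q s w) α β) s) →
      (∀ s ∈ Set.Icc 0 T, ∀ (w : Site 4) (α β : Fin 4), ‖X s w α β‖ ≤ B) →
      (∀ s ∈ Set.Icc 0 T, ∀ (w : Site 4) (α β : Fin 4), ‖q s w α β‖ ≤ B * gaussProfile c s w) →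
      ∀ t ∈ Set.Icc 0 T, ∀ (w : Site 4) (α β : Fin 4),
        X t w α β = -∫ s in (0 : ℝ)..t, (∑' y : Site 4,
          Complex.exp (((θ / 2 * (wedge y w : ℤ) : ℝ) : ℂ) * Complex.I) •
            (symHeat θ (t - s) y * q s (w - y))) α β)
    (θ : ℝ) {t : ℝ} (ht : 0 < t) (w : Site 4) (α β : Fin 4) :
    (symHeat θ t w - pert0 t w - (θ : ℂ) • pert1 t w) α β =
      -∫ s in (0 : ℝ)..t, (∑' y : Site 4,
          Complex.exp (((θ / 2 * (wedge y w : ℤ) : ℝ) : ℂ) * Complex.I) •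
            (symHeat θ (t - s) y * Q₂[θ, s, w - y])) α β := by
  obtain ⟨C₁, hC₁0, hR⟩ := norm_remainder₂_apply_le hck hk hT4 h1 h3 h5 h6
  obtain ⟨K, hK0, hq⟩ := exists_forcing_bounds hck hk hT3 hT4 h1 h3 h5 h6
  set BR : ℝ := Real.exp (1679616 * t) + Ck + |θ| * (C₁ * (1 + t)) with hBR
  set Bq : ℝ := K * (θ ^ 2 * (1 + t) + |θ| ^ 3 * (1 + t) ^ 2) with hBq
  have hCk : 0 ≤ Ck := by
    have := hk 0 le_rfl 0
    have h0 : 0 < gaussProfile ck 0 0 := by rw [gaussProfile_zero_right]; norm_num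
    nlinarith [abs_nonneg (freeKer 0 0)]
  have hBR0 : 0 ≤ BR := by rw [hBR]; positivity
  have hBq0 : 0 ≤ Bq := by rw [hBq]; positivity
  have key := hTD θ t (ck / 8) (BR + Bq) ht (by positivity)
    (fun s w => symHeat θ s w - pert0 s w - (θ : ℂ) • pert1 s w) (fun s w => Q₂[θ, s, w])
    (fun w => remainder₂_zero h1 h3 h5 h6 θ w)
    (fun w α β => (continuousOn_remainder₂_apply h1 h3 h4 h5 h6 θ w α β).mono fun s hs => hs.1)
    (fun w α β => (continuousOn_forcing₂_apply h1 h3 h4 h5 h6 θ w α β).mono fun s hs => hs.1)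
    (fun s hs w α β => hasDerivAt_remainder₂_apply h1 h3 h4 h5 h6 θ hs.1 w α β)
    (fun s hs w α β => (hR θ t s hs w α β).trans (le_add_of_nonneg_right hBq0))
    (fun s hs w α β => ?_) t ⟨ht.le, le_rfl⟩ w α β
  · exact key
  · -- the forcing bound on `[0, t]`
    have h := (hq θ s hs.1 w α β).2.2.1
    refine h.trans ?_
    have hΓ := gaussProfile_nonneg (ck / 8) s w
    have hmono : K * (θ ^ 2 * (1 + s) + |θ| ^ 3 * (1 + s) ^ 2) ≤ Bq := by
      rw [hBq]
      have hs1 : 1 + s ≤ 1 + t := by linarith [hs.2]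
      have hs0 : 0 ≤ 1 + s := by linarith [hs.1]
      gcongr
    calc K * (θ ^ 2 * (1 + s) + |θ| ^ 3 * (1 + s) ^ 2) * gaussProfile (ck / 8) s w
        ≤ Bq * gaussProfile (ck / 8) s w := mul_le_mul_of_nonneg_right hmono hΓ
      _ ≤ (BR + Bq) * gaussProfile (ck / 8) s w := by gcongr; linarith

/-! ## Registered headline -/

/-- Registered headline of this helper file (aux stub `stub_secondOrderExpansionAuxK` of crux
stmt-QuantumFields-16786, line `Sketch`): `R₂(0) = 0`. -/
theorem stub_secondOrderExpansionAuxK : (∀ x y : Site 4, sqKer (fun _ => (1 : ℂ)) x y = ((hhat (y - x) : ℝ) : ℂ) • (1 : Spin)) → (∀ w : Site 4, freeKer 0 w = if w = 0 then 1 else 0) → (∀ s r : ℝ, 0 ≤ s → 0 ≤ r → ∀ w : Site 4, HasSum (fun y : Site 4 => freeKer s y * freeKer r (w - y)) (freeKer (s + r) w)) → (∀ t : ℝ, 0 ≤ t → ∀ (w : Site 4) (ν : Fin 4), t * (∑ z ∈ nbr2 0, ((z ν : ℤ) : ℝ) * hhat z * freeKer t (w - z)) + ((w ν : ℤ) : ℝ)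 * freeKer t w = 0) → ∀ (θ : ℝ) (w : Site 4), symHeat θ 0 w - pert0 0 w - (θ : ℂ) • pert1 0 w = 0 :=
  fun h1 h3 h5 h6 θ w => remainder₂_zero h1 h3 h5 h6 θ w

end Summit.QuantumFields.QCD.Cruxes.QuarkLoopCoefficient.Sketch.SecondOrderExpansion

end
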